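import Literature.Analysis.FluidPDE.BurgersVortexLayer
import Literature.Analysis.FluidPDE.StrainedAzimuthalFlow
import HarnessLib

/-!
# The Burgers vortex layer is an exact steady Navier–Stokes solution (proof)

Analysis/FluidPDE proofs file (work item `defn-BurgersVortexInStrain`, part (b); all results
proved). In the plane strain `U_s(x) = (−γx₀, 0, γx₂) = P x`, `P = diag(−γ, 0, γ)`
(`planeStrain γ`), a unidirectional shear `v(x) = (0, V(x₀), 0) = V(x₀) e₁` gives

* `Du(x)h = P h + V'(x₀) h₀ e₁`, so `div u = tr P = 0` and
  `((U_s + v)·∇)(U_s + v) = P(Px) − γ x₀ V'(x₀) e₁` (`P e₁ = 0`, `(Px + V e₁)₀ = −γx₀`);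
* `Δu = V''(x₀) e₁` (`ΔP = 0`), `curl u = V'(x₀) e₂` (`curl_burgersLayer`);
* the strain pressure `p = −½|Px|²` has `∇p = −P(Px)`;

hence the steady momentum equation `(u·∇)u = νΔu − ∇p` reduces to the ODE

  `ν V''(s) = −γ s V'(s)`        (`isSteadyClassicalNS_shear`),

solved by the erf profile `V = burgersLayerProfile γ ν ΔU` (`V' ∝ e^{−γs²/(2ν)}`). Consequently
`burgersLayer γ ν ΔU = planeStrain γ + burgersLayerVelocity γ ν ΔU` with the pressure
`burgersLayerPressure γ` is a steady classical Navier–Stokes solution for ALL `γ, ν, ΔU`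
(`burgersLayer_isSteadyClassicalNS`; in the unphysical range `γ/(2ν) ≤ 0` the junk value of the
profile is `V ≡ 0` and the statement degenerates to the pure strain), and
`burgersLayerInStrain : IsSteadyNSInStrain ν (planeStrain γ) (burgersLayerVelocity γ ν ΔU)`
(Burgers 1948; Gallay–Maekawa 2016, §1: a strain with two positive principal rates forms vortex sheets).

## References

* J. M. Burgers, *A mathematical model illustrating the theory of turbulence*, Adv. Appl. Mech. 1
  (1948) 171–199.
* Th. Gallay, C. E. Wayne, arXiv:math/0503353, (1.1) (`λ = 1`: plane strain). [GallayWayne2006]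
* Th. Gallay, Y. Maekawa, arXiv:1610.08384, §1. [GallayMaekawa2016]
-/

noncomputable section

open Set Function Filter Topology WithLp MeasureTheory InnerProductSpace
open scoped Laplacian RealInnerProductSpace ContDiff

namespace Literature.Analysis.FluidPDE

/-- Local notation for physical space `ℝ³ = EuclideanSpace ℝ (Fin 3)`. -/
local notation "ℝ³" => EuclideanSpace ℝ (Fin 3)

namespace StrainedShear

/-! ### Unidirectional shears `V(x₀) e₁` in the plane strain -/

section Shear

variable {γ ν : ℝ} {V V' V'' : ℝ → ℝ}

/-- The shear direction `e₁ = (0, 1, 0)` (the neutral direction of the plane strain). [folklore] -/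
def eOne : ℝ³ :=
  EuclideanSpace.single 1 1

/-- Components of `e₁`. [folklore] -/
@[simp] theorem eOne_apply_zero : eOne 0 = 0 := by simp [eOne]

/-- Components of `e₁`. [folklore] -/
@[simp] theorem eOne_apply_one : eOne 1 = 1 := by simp [eOne]

/-- Components of `e₁`. [folklore] -/
@[simp] theorem eOne_apply_two : eOne 2 = 0 := by simp [eOne]

/-- The plane strain matrix `P = diag(−γ, 0, γ)` as a continuous linear map. [folklore] -/
abbrev planeStrainL (γ : ℝ) : ℝ³ →L[ℝ] ℝ³ :=
  linearStrainL (-γ) 0 γ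

/-- `planeStrain γ = planeStrainL γ` as functions. [folklore] -/
theorem planeStrain_eq (γ : ℝ) : planeStrain γ = fun x => planeStrainL γ x := rfl

/-- The plane strain annihilates the neutral direction: `P e₁ = 0`. [folklore] -/
@[simp] theorem planeStrainL_eOne (γ : ℝ) : planeStrainL γ eOne = 0 := by
  ext i; fin_cases i <;> simp [linearStrain, eOne]

/-- The plane strain is smooth. [folklore] -/
theorem contDiff_planeStrain (γ : ℝ) {n : WithTop ℕ∞} : ContDiff ℝ n (planeStrain γ) :=
  contDiff_linearStrain _ _ _

/-- The unidirectional shear with profile `V`: `v(x) = V(x₀) e₁ = (0, V(x₀), 0)`. [folklore] -/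
def shear (V : ℝ → ℝ) (x : ℝ³) : ℝ³ :=
  V (x 0) • eOne

/-- The strain pressure `p(x) = −½|Px|² = −½γ²(x₀² + x₂²)` of the plane strain; the shear
carries no pressure. [folklore] -/
def strainPressure (γ : ℝ) (x : ℝ³) : ℝ :=
  -2⁻¹ * ‖planeStrainL γ x‖ ^ 2

/-- A function of `x₀` alone is as smooth as its profile. [folklore] -/
theorem contDiff_comp_coord_zero {n : WithTop ℕ∞} (hV : ContDiff ℝ n V) :
    ContDiff ℝ n (fun x : ℝ³ => V (x 0)) :=
  hV.comp (contDiff_piLp_apply (p := 2))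

/-- The shear is as smooth as its profile. [folklore] -/
theorem contDiff_shear {n : WithTop ℕ∞} (hV : ContDiff ℝ n V) : ContDiff ℝ n (shear V) :=
  (contDiff_comp_coord_zero hV).smul contDiff_const

/-- Chain rule through the coordinate `x₀`: `D(V(x₀))(x) = V'(x₀) dx₀`. [folklore] -/
theorem hasFDerivAt_comp_coord_zero (hV : ∀ s, HasDerivAt V (V' s) s) (x : ℝ³) :
    HasFDerivAt (fun y : ℝ³ => V (y 0)) (V' (x 0) • (EuclideanSpace.proj 0 : ℝ³ →L[ℝ] ℝ)) x :=
  (hV (x 0)).comp_hasFDerivAt x (EuclideanSpace.proj (0 : Fin 3) : ℝ³ →L[ℝ] ℝ).hasFDerivAt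

/-- **The derivative of the shear**: `Dv(x) h = (V'(x₀) h₀) e₁`. [folklore] -/
theorem hasFDerivAt_shear (hV : ∀ s, HasDerivAt V (V' s) s) (x : ℝ³) :
    HasFDerivAt (shear V)
      ((V' (x 0) • (EuclideanSpace.proj 0 : ℝ³ →L[ℝ] ℝ)).smulRight eOne) x :=
  (hasFDerivAt_comp_coord_zero hV x).smul_const eOne

/-- The derivative of the shear applied to a vector. [folklore] -/
theorem fderiv_shear_apply (hV : ∀ s, HasDerivAt V (V' s) s) (x h : ℝ³) :
    fderiv ℝ (shear V) x h = (V' (x 0) * h 0) • eOne := by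
  rw [(hasFDerivAt_shear hV x).fderiv]
  simp

/-- **The Laplacian of a function of `x₀` alone** is its second derivative:
`Δ(V(x₀)) = V''(x₀)`. [folklore] -/
theorem laplacian_comp_coord_zero (hV2 : ContDiff ℝ 2 V) (x : ℝ³) :
    Δ (fun x : ℝ³ => V (x 0)) x = iteratedDeriv 2 V (x 0) := by
  rw [laplacian_eq_iteratedFDeriv_orthonormalBasis _ (EuclideanSpace.basisFun (Fin 3) ℝ)]
  have hcomp : (fun x : ℝ³ => V (x 0)) = V ∘ (EuclideanSpace.proj (0 : Fin 3) : ℝ³ →L[ℝ] ℝ) := rfl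
  simp only [hcomp, ContinuousLinearMap.iteratedFDeriv_comp_right _ hV2 x (i := 2) le_rfl,
    ContinuousMultilinearMap.compContinuousLinearMap_apply, EuclideanSpace.basisFun_apply,
    Fin.sum_univ_three, iteratedFDeriv_apply_eq_iteratedDeriv_mul_prod, Fin.prod_univ_two]
  simp

/-- `iteratedDeriv 2 V = V''` from the two derivative hypotheses. [folklore] -/
theorem iteratedDeriv_two_eq (hV : ∀ s, HasDerivAt V (V' s) s) (hV' : ∀ s, HasDerivAt V' (V'' s) s)
    (s : ℝ) : iteratedDeriv 2 V s = V'' s := by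
  rw [iteratedDeriv_succ, iteratedDeriv_one]
  have h1 : deriv V = V' := funext fun t => (hV t).deriv
  rw [h1, (hV' s).deriv]

/-- **The Laplacian of the shear**: `Δv(x) = V''(x₀) e₁`. [folklore] -/
theorem laplacian_shear (hV2 : ContDiff ℝ 2 V) (hV : ∀ s, HasDerivAt V (V' s) s)
    (hV' : ∀ s, HasDerivAt V' (V'' s) s) (x : ℝ³) : Δ (shear V) x = V'' (x 0) • eOne := by
  have hL : shear V = ((1 : ℝ →L[ℝ] ℝ).smulRight eOne) ∘ (fun y : ℝ³ => V (y 0)) := by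
    funext y; simp [shear]
  rw [hL, ContDiffAt.laplacian_CLM_comp_left (contDiff_comp_coord_zero hV2).contDiffAt,
    Function.comp_apply, laplacian_comp_coord_zero hV2, iteratedDeriv_two_eq hV hV']
  simp

/-- **The vorticity of a strained shear** `planeStrain γ + V(x₀)e₁` is `V'(x₀) e₂` (the strain is
irrotational; `ω_z = ∂₀v₁`). [folklore] -/
theorem curl_planeStrain_add_shear (hV : ∀ s, HasDerivAt V (V' s) s) (γ : ℝ) (x : ℝ³) :
    curl (planeStrain γ + shear V) x = V' (x 0) • EuclideanSpace.single 2 1 := by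
  have hdU : DifferentiableAt ℝ (planeStrain γ) x :=
    (hasFDerivAt_linearStrain _ _ _ x).differentiableAt
  have hU : fderiv ℝ (planeStrain γ) x = planeStrainL γ :=
    (hasFDerivAt_linearStrain _ _ _ x).fderiv
  have hD : fderiv ℝ (planeStrain γ + shear V) x = planeStrainL γ + fderiv ℝ (shear V) x := by
    rw [fderiv_add hdU (hasFDerivAt_shear hV x).differentiableAt, hU]
  ext i
  fin_cases i <;> simp [curl, hD, fderiv_shear_apply hV, linearStrain, eOne]

/-- The Laplacian of the plane strain vanishes. [folklore] -/
theorem laplacian_planeStrainL (γ : ℝ) (x : ℝ³) : Δ (fun y => planeStrainL γ y) x = 0 :=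
  StrainedAzimuthal.laplacian_linearStrainL _ _ _ x

/-- **The gradient of the strain pressure** is `−P(Px)`. [folklore] -/
theorem gradient_strainPressure (γ : ℝ) (x : ℝ³) :
    gradient (strainPressure γ) x = -(planeStrainL γ (planeStrainL γ x)) :=
  (StrainedAzimuthal.hasGradientAt_linearStrainPressure _ _ _ x).gradient

/-- The strain pressure is smooth. [folklore] -/
theorem contDiff_strainPressure (γ : ℝ) : ContDiff ℝ ∞ (strainPressure γ) :=
  contDiff_const.mul ((contDiff_norm_sq ℝ).comp (planeStrainL γ).contDiff)

/-- **Steady Navier–Stokes for strained shears.** If the smooth profile `V` satisfies the ODE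
`ν V''(s) = −γ s V'(s)`, then `U_s + V(x₀)e₁` with the strain pressure `−½|Px|²` is a steady
classical solution of the unforced Navier–Stokes equations with viscosity `ν` in the plane
strain `U_s = planeStrain γ` (the computation behind Burgers' 1948 vortex layer). [folklore] -/
theorem isSteadyClassicalNS_shear (hVs : ContDiff ℝ ∞ V) (hV : ∀ s, HasDerivAt V (V' s) s)
    (hV' : ∀ s, HasDerivAt V' (V'' s) s) (hode : ∀ s, ν * V'' s = -(γ * s * V' s)) :
    IsSteadyClassicalNS ν 0 (planeStrain γ + shear V) (strainPressure γ) where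
  smooth_velocity := (contDiff_planeStrain γ).add (contDiff_shear hVs)
  smooth_pressure := contDiff_strainPressure γ
  momentum x := by
    have hU : fderiv ℝ (planeStrain γ) x = planeStrainL γ :=
      (hasFDerivAt_linearStrain _ _ _ x).fderiv
    have hdU : DifferentiableAt ℝ (planeStrain γ) x :=
      (hasFDerivAt_linearStrain _ _ _ x).differentiableAt
    have hdv : DifferentiableAt ℝ (shear V) x := (hasFDerivAt_shear hV x).differentiableAt
    have hconv : convect (planeStrain γ + shear V) (planeStrain γ + shear V) x =
        planeStrainL γ (planeStrainL γ x) + (V' (x 0) * (-γ * x 0)) • eOne := by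
      rw [convect_apply, fderiv_add hdU hdv, hU, _root_.add_apply,
        fderiv_shear_apply hV]
      ext i
      fin_cases i <;> simp [shear, planeStrain, linearStrain, eOne]
    have hlap : Δ (planeStrain γ + shear V) x = V'' (x 0) • eOne := by
      rw [ContDiffAt.laplacian_add ((contDiff_planeStrain γ).contDiffAt)
        (((contDiff_shear hVs).of_le (by norm_cast)).contDiffAt),
        planeStrain_eq, laplacian_planeStrainL, zero_add,
        laplacian_shear (hVs.of_le (by norm_cast)) hV hV' x]
    rw [hconv, hlap, gradient_strainPressure]
    have hode' := hode (x 0)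
    ext i
    fin_cases i
    · simp [linearStrain, eOne]
    · simp [linearStrain, eOne]
      linear_combination -hode'
    · simp [linearStrain, eOne]
  divFree x := by
    have hU : fderiv ℝ (planeStrain γ) x = planeStrainL γ :=
      (hasFDerivAt_linearStrain _ _ _ x).fderiv
    have hdU : DifferentiableAt ℝ (planeStrain γ) x :=
      (hasFDerivAt_linearStrain _ _ _ x).differentiableAt
    have hdv : DifferentiableAt ℝ (shear V) x := (hasFDerivAt_shear hV x).differentiableAt
    rw [divergence_eq_sum_inner_fderiv (EuclideanSpace.basisFun (Fin 3) ℝ), fderiv_add hdU hdv, hU]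
    simp only [Fin.sum_univ_three, EuclideanSpace.basisFun_apply, _root_.add_apply,
      fderiv_shear_apply hV, EuclideanSpace.inner_single_left, map_one, one_mul]
    simp [linearStrain, eOne]

end Shear

end StrainedShear

open StrainedShear

/-! ### The Burgers vortex layer -/

/-- The derivative `V'(s) = (ΔU/√π) κ e^{−(κs)²}` of the layer profile, as a named function
(`hasDerivAt_burgersLayerProfile`). [folklore] -/
def burgersLayerProfileD (γ ν ΔU : ℝ) (s : ℝ) : ℝ :=
  ΔU / Real.sqrt Real.pi * (burgersLayerRate γ ν * Real.exp (-(burgersLayerRate γ ν * s) ^ 2))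

/-- The second derivative `V''(s) = −2κ² s V'(s)` of the layer profile. [folklore] -/
def burgersLayerProfileDD (γ ν ΔU : ℝ) (s : ℝ) : ℝ :=
  -(2 * burgersLayerRate γ ν ^ 2 * s) * burgersLayerProfileD γ ν ΔU s

/-- `V' = burgersLayerProfileD`. [folklore] -/
theorem hasDerivAt_burgersLayerProfile' (γ ν ΔU s : ℝ) :
    HasDerivAt (burgersLayerProfile γ ν ΔU) (burgersLayerProfileD γ ν ΔU s) s :=
  hasDerivAt_burgersLayerProfile γ ν ΔU s

/-- `V'' = burgersLayerProfileDD`: differentiating the Gaussian `e^{−(κs)²}` brings down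
`−2κ² s`. [folklore] -/
theorem hasDerivAt_burgersLayerProfileD (γ ν ΔU s : ℝ) :
    HasDerivAt (burgersLayerProfileD γ ν ΔU) (burgersLayerProfileDD γ ν ΔU s) s := by
  set κ := burgersLayerRate γ ν with hκ
  have hlin : HasDerivAt (fun u : ℝ => κ * u) κ s := by
    simpa using (hasDerivAt_id s).const_mul κ
  have hsq : HasDerivAt (fun u : ℝ => -(κ * u) ^ 2) (-(2 * (κ * s) * κ)) s := by
    simpa using (hlin.fun_pow 2).fun_neg
  have hexp : HasDerivAt (fun u : ℝ => Real.exp (-(κ * u) ^ 2))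
      (Real.exp (-(κ * s) ^ 2) * (-(2 * (κ * s) * κ))) s := hsq.exp
  have h := (hexp.const_mul κ).const_mul (ΔU / Real.sqrt Real.pi)
  refine h.congr_deriv ?_
  simp only [burgersLayerProfileDD, burgersLayerProfileD]
  ring

/-- **The layer profile solves `ν V'' = −γ s V'`** for all `γ, ν` (when `κ = (γ/2ν)^{1/2} > 0`
this is `2νκ² = γ`; in the junk range `κ = 0` both sides vanish). [folklore] -/
theorem burgersLayerProfile_ode (γ ν ΔU s : ℝ) :
    ν * burgersLayerProfileDD γ ν ΔU s = -(γ * s * burgersLayerProfileD γ ν ΔU s) := by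
  by_cases hκ : burgersLayerRate γ ν = 0
  · simp [burgersLayerProfileDD, burgersLayerProfileD, hκ]
  · have hpos : 0 < γ / (2 * ν) := Real.sqrt_ne_zero'.1 hκ
    have hν : ν ≠ 0 := by
      rintro rfl
      simp at hpos
    have hsq : burgersLayerRate γ ν ^ 2 = γ / (2 * ν) := burgersLayerRate_sq hpos.le
    have h2 : ν * (2 * (γ / (2 * ν))) = γ := by field_simp
    rw [burgersLayerProfileDD, hsq]
    linear_combination (-(s * burgersLayerProfileD γ ν ΔU s)) * h2

/-- The layer velocity is the shear with the erf profile. [folklore] -/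
theorem burgersLayerVelocity_eq_shear (γ ν ΔU : ℝ) :
    burgersLayerVelocity γ ν ΔU = shear (burgersLayerProfile γ ν ΔU) := by
  funext x
  ext i
  fin_cases i <;> simp [burgersLayerVelocity, shear]

/-- The **pressure of the Burgers vortex layer**: the pure strain pressure
`p(x) = −½|U_s(x)|² = −½γ²(x₀² + x₂²)` (the shear `(0, V(x₀), 0)` is pressureless). [folklore] -/
def burgersLayerPressure (γ : ℝ) : EuclideanSpace ℝ (Fin 3) → ℝ :=
  strainPressure γ

/-- **The Burgers vortex layer is an exact steady solution of the Navier–Stokes equations**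
(Burgers 1948; cf. Gallay–Maekawa 2016, §1 on strained vortex sheets): for every viscosity `ν`, strain rate `γ` and
velocity jump `ΔU`, the velocity `burgersLayer γ ν ΔU = planeStrain γ + burgersLayerVelocity γ ν ΔU`
and the pressure `burgersLayerPressure γ` are smooth on `ℝ³` and satisfy `(u·∇)u = νΔu − ∇p`,
`div u = 0` pointwise. (Physical case `γ, ν > 0`; for `γ/(2ν) ≤ 0` the profile is the junk value
`V ≡ 0` and the statement is that of the pure strain.) [folklore] -/
theorem burgersLayer_isSteadyClassicalNS (γ ν ΔU : ℝ) :
    IsSteadyClassicalNS ν 0 (burgersLayer γ ν ΔU) (burgersLayerPressure γ) := by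
  have h := isSteadyClassicalNS_shear (γ := γ) (ν := ν) (contDiff_burgersLayerProfile γ ν ΔU)
    (hasDerivAt_burgersLayerProfile' γ ν ΔU) (hasDerivAt_burgersLayerProfileD γ ν ΔU)
    (burgersLayerProfile_ode γ ν ΔU)
  rw [← burgersLayerVelocity_eq_shear] at h
  exact h

/-- **The vorticity of the Burgers layer** is the Gaussian sheet
`ω = V'(x₀) e₂ = ΔU (γ/2πν)^{1/2} e^{−γx₀²/(2ν)} e₂` (`V' = burgersLayerProfileD`,
cf. `deriv_burgersLayerProfile`). [folklore] -/
theorem curl_burgersLayer (γ ν ΔU : ℝ) (x : ℝ³) :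
    curl (burgersLayer γ ν ΔU) x = burgersLayerProfileD γ ν ΔU (x 0) • EuclideanSpace.single 2 1 := by
  rw [burgersLayer, burgersLayerVelocity_eq_shear]
  exact curl_planeStrain_add_shear (hasDerivAt_burgersLayerProfile' γ ν ΔU) γ x

/-- **The Burgers vortex layer in strain**: `IsSteadyNSInStrain ν (planeStrain γ) v` for the layer
velocity `v = burgersLayerVelocity γ ν ΔU`, for all `γ, ν, ΔU`. [folklore] -/
theorem burgersLayerInStrain (γ ν ΔU : ℝ) :
    IsSteadyNSInStrain ν (planeStrain γ) (burgersLayerVelocity γ ν ΔU) :=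
  ⟨burgersLayerPressure γ, burgersLayer_isSteadyClassicalNS γ ν ΔU⟩

end Literature.Analysis.FluidPDE
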